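import Summits.QuantumFields.BalabanUV.T4Continuum.Support.AveragingDeficitMultiLevelBridge
import HarnessLib

/-!
# AveragingDeficitFermatAll (T⁴ programme, node NE3, row NE3-R2, gen 6) — R0 FOR DIRECTIONS OF GENERAL SUPPORT: the Fermat
# theorems of gen 3 (`fineCritical_of_isLocalMin`, `fineCritical_multiLevel`) with the face-support restriction of the direction
# DROPPED (`FineCriticalAll`) — the constrained minimiser is critical for the fine Wilson action along EVERY periodic `𝔲(N)`
# direction whose push-forward is tangent (needed by the gradient-bounded lift of (γ2), which is not face-supported)

HONEST FRAMING (cell `pub-balaban`, T4-DAG PAGE 1; unit `b2b-balaban-t4-ne3r2-p1` = owner of BINDER-OWNERS row NE3-R2, gen 6).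
The cell's T4 target is the finite-torus continuum limit of the unit-scale averaged loop expectations — NOT infinite volume, NO
mass gap, NOT Clay, NOT summit progress.  WHY.  Gen 2's hypothesis shape `AveragingDeficitDualResidual.FineCritical L M V Tc`
quantifies over FACE-SUPPORTED directions only (those of gen 2's lift (γ1)); gen 3's proof of it for constrained minimisers
(`AveragingDeficitFermat.fineCritical_of_isLocalMin`: Lagrange multipliers on the torus chart) never uses the face support.  The
gradient-bounded lift `AveragingDeficitGradLift.gradLift` of (γ2) is supported on whole blocks, so the curl∕gradient-paired residual
R2ᴱ_w needs criticality along directions of general support.  THIS FILE restates the two gen-3 theorems with the restriction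
dropped — SAME PROOFS (verbatim up to the omitted binder), 0 sorry: §1 `FineCriticalAll` and `FineCriticalAll.fineCritical`;
§2 **`fineCriticalAll_of_isLocalMin`**; §3 **`fineCriticalAll_multiLevel`** (Bałaban's `(j+2)`-level composite-constraint minimisers,
every `j`) and `fineCriticalAll_avgIter` (the constraint as «same `(j+2)`-fold average (43)»).  NE3 ITSELF IS NOT PROVED; nothing of
Bałaban's is asserted (context: [Balaban1985Variational] (75)–(77) p. 289, (82)–(84) p. 290, §E (115)–(121) p. 295).  ABSOLUTE RULE
kept: no printed sentence is a hypothesis.  PLACEMENT: `Summits/QuantumFields/BalabanUV/`; imports this row's gen-3 top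
`AveragingDeficitMultiLevelBridge`; moves nothing.
-/

set_option autoImplicit false

open scoped BigOperators Matrix Matrix.Norms.L2Operator Topology
open NormedSpace Finset Filter

namespace Summit.QuantumFields.BalabanUV.T4Continuum.AveragingDeficitFermatAll

open Literature.MathematicalPhysics.QuantumFieldTheory.Balaban1983to89
open B7Prop1Explicit B7Prop2Explicit MatrixLog UnitaryModel
open T4AveragingDeficitWall hiding Site Plane Plaq Bond
open T4AveragingDeficitWallBoundary (IsPeriodicCfg periodBox)
open T4AveragingDeficitNonAbelian (hol_add_period)
open AveragingDeficitTransport AveragingDeficitPlaqDeriv AveragingDeficitSideDeriv AveragingDeficitPeriodicCounting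
open AveragingDeficitDerivWallProof AveragingDeficitResidualPairing AveragingDeficitFaceWords AveragingDeficitFaceLift
open AveragingDeficitLiftPeriodic
open AveragingDeficitDualResidual AveragingDeficitTorusChart AveragingDeficitChartCalculus AveragingDeficitFermat
open AveragingDeficitTwoLevelPrep AveragingDeficitTwoLevelFermat AveragingDeficitMultiLevelPrep AveragingDeficitMultiLevelFermat
open AveragingDeficitMultiLevelBridge

noncomputable section

variable {d : ℕ} {n : Type*} [Fintype n] [DecidableEq n]

/-! ## §1 Fine criticality along directions of general support -/

/-- FINE CRITICALITY ALONG LIFTED DIRECTIONS OF GENERAL SUPPORT: `V` is critical for the fine Wilson action of the period along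
every PERIODIC `𝔲(N)` direction whose push-forward is admissible (`Tc`) — gen 2's `FineCritical` without the face-support binder.
[cite: Balaban1985Variational, (75)–(76) p.289, (83) p.290, §E (115)–(121) p.295] -/
def FineCriticalAll (L M : ℕ) (V : Site d → Fin d → (Matrix n n ℂ)ˣ) (Tc : (Site d → Fin d → Matrix n n ℂ) → Prop) : Prop :=
  ∀ ψ : Site d → Fin d → Matrix n n ℂ, IsSkewDir ψ → IsPeriodicDir ψ ((L : ℤ) * M) →
    Tc (fun y κ => pushDir L V ψ ((L : ℤ) • y) κ) →
      HasDerivAt (fun s : ℝ => fineAction (vary V ψ s) (blockWindow L (periodBox M)).2) 0 0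

/-- The general-support shape implies gen 2's face-supported one. [folklore] -/
theorem FineCriticalAll.fineCritical {L M : ℕ} {V : Site d → Fin d → (Matrix n n ℂ)ˣ}
    {Tc : (Site d → Fin d → Matrix n n ℂ) → Prop} (h : FineCriticalAll L M V Tc) : FineCritical L M V Tc :=
  fun ψ hψs hψP _ hTc => h ψ hψs hψP hTc

/-! ## §2 Fermat on the constraint manifold, general support -/

/-- **R0, GENERAL SUPPORT** — gen 3's `fineCritical_of_isLocalMin` with the face-support binder dropped (same proof: Lagrange
multipliers on the finite torus chart for `f = Q ∘ cavg ∘ chart`, strictly differentiable with onto differential).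
[cite: Balaban1985Variational, (75)–(77) p.289, (82)–(84) p.290, §E (115)–(121) p.295] -/
theorem fineCriticalAll_of_isLocalMin [Nonempty n] {L M : ℕ} [NeZero L] [NeZero M] {V : Site d → Fin d → (Matrix n n ℂ)ˣ}
    (hV : IsUnitaryCfg V) (hVP : IsPeriodicCfg V ((L : ℤ) * M)) {a : ℝ} (ha : 0 ≤ a)
    (hsmall : liftSmall d L * a ≤ 1) (hVa : SmallField V a)
    {G : Type*} [NormedAddCommGroup G] [NormedSpace ℝ G] [CompleteSpace G]
    (Q : (Site d → Fin d → (Matrix n n ℂ)ˣ) → G) (Q' : TDir d n M →L[ℝ] G)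
    (hQ : HasStrictFDerivAt (fun Φ : TDir d n M => Q (chart (ContinuousLinearMap.id ℝ (Matrix n n ℂ)) M (cavg L V) Φ)) Q' 0)
    (hQ' : ∀ γ : G, ∃ Φ : TDir d n M, (∀ r κ, Φ r κ ∈ skewAdjoint (Matrix n n ℂ)) ∧ Q' Φ = γ)
    (Near : (Site d → Fin d → (Matrix n n ℂ)ˣ) → Prop) (hNear : ∀ᶠ θ in 𝓝 (0 : TDir d n (L * M)), Near (chart skewP (L * M) V θ))
    (hmin : ∀ U : Site d → Fin d → (Matrix n n ℂ)ˣ, IsUnitaryCfg U → IsPeriodicCfg U ((L : ℤ) * M) → Near U →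
      Q (cavg L U) = Q (cavg L V) →
        fineAction V (blockWindow L (periodBox M)).2 ≤ fineAction U (blockWindow L (periodBox M)).2) :
    FineCriticalAll L M V (fun φ => Q' (resDir M φ) = 0) := by
  have hL : 1 ≤ L := Nat.one_le_iff_ne_zero.mpr (NeZero.ne L)
  have h512 : 512 * (d + 1) * (d + 4) * (L : ℝ) ^ 2 * a ≤ 1 := small512_of_liftSmall hL ha hsmall
  have hW : ∀ (q : Site d) (κ : Fin d) (r : Fin d → Fin L), ‖((Wcx L V q κ (boxVec L r) : (Matrix n n ℂ)ˣ) : Matrix n n ℂ) - 1‖ < 1 :=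
    norm_Wcx_sub_one_lt_one_of_smallField L hL hV ha h512 hVa
  have hVP' : IsPeriodicCfg V ((L * M : ℕ) : ℤ) := by rw [natCast_mul_period]; exact hVP
  intro ψ hψs hψP hTc
  set Wf := (blockWindow L (periodBox (d := d) M)).2 with hWf
  -- the chart action and the chart constraint
  set A : TDir d n (L * M) → ℝ := fun θ => fineAction (chart skewP (L * M) V θ) Wf with hA
  set F : TDir d n (L * M) → G := fun θ => Q (cavg L (chart skewP (L * M) V θ)) with hF
  -- strict differentiability of the action
  have hAd : HasStrictFDerivAt A (fderiv ℝ A 0) 0 :=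
    (contDiffAt_fineAction_chart (m := 1) skewP (L * M) V Wf 0).hasStrictFDerivAt one_ne_zero
  -- strict differentiability of the constraint: `F = Q ∘ chart_id ∘ coord` near `0`
  have hcoord : HasStrictFDerivAt (coord skewP L M V) (fderiv ℝ (coord skewP L M V) 0) 0 :=
    (contDiffAt_coord (m := 1) skewP L M V hW).hasStrictFDerivAt one_ne_zero
  have hQ0 : HasStrictFDerivAt (fun Φ : TDir d n M => Q (chart (ContinuousLinearMap.id ℝ (Matrix n n ℂ)) M (cavg L V) Φ)) Q'
      (coord skewP L M V 0) := by
    rw [coord_zero]; exact hQ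
  have hFd : HasStrictFDerivAt F (Q'.comp (fderiv ℝ (coord skewP L M V) 0)) 0 := by
    refine (hQ0.comp 0 hcoord).congr_of_eventuallyEq ?_
    exact (eventually_cavg_chart_eq hL hV hVP ha h512 hVa).mono fun θ hθ => by
      simp only [hF, hθ]
  -- the differential of the constraint is onto (the periodic lift)
  have hsurj : Function.Surjective (Q'.comp (fderiv ℝ (coord skewP L M V) 0)) := by
    intro γ
    obtain ⟨Φ, hΦs, hΦ⟩ := hQ' γ
    have hφP : ∀ (y : Site d) (j κ : Fin d), extDir M Φ (y + (M : ℤ) • e j) κ = extDir M Φ y κ :=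
      fun y j κ => isPeriodicDir_extDir M Φ y j κ
    obtain ⟨χ, hχF, hχP, hχpush, -, hχs⟩ := exists_lift_periodic hL hV hVP ha hsmall hVa (extDir M Φ) hφP
    have hχskew : IsSkewDir χ := hχs fun y κ => hΦs _ _
    have hχP' : IsPeriodicDir χ ((L * M : ℕ) : ℤ) := by rw [natCast_mul_period]; exact hχP
    refine ⟨resDir (L * M) χ, ?_⟩
    rw [ContinuousLinearMap.comp_apply, ← hΦ]
    congr 1
    funext r κ
    rw [fderiv_coord_apply skewP L M V hW, chartDir_skewP_resDir (L * M) hχP' hχskew, hχpush]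
    simp only [extDir, redN_boxVec]
  -- the minimiser is a local minimiser in the chart
  have hloc : IsLocalMinOn A {θ | F θ = F 0} 0 := by
    refine eventually_nhdsWithin_iff.mpr (hNear.mono fun θ hθ hθF => ?_)
    simp only [Set.mem_setOf_eq, hF, chart_zero] at hθF
    simp only [hA, chart_zero]
    have hθP : IsPeriodicCfg (chart skewP (L * M) V θ) ((L : ℤ) * M) := by
      have h := isPeriodicCfg_chart skewP (L * M) hVP' θ
      rw [natCast_mul_period] at h
      exact h
    exact hmin _ (isUnitaryCfg_chart (L * M) hV θ) hθP hθ hθF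
  -- Fermat along the restriction of `ψ`
  have hψP' : IsPeriodicDir ψ ((L * M : ℕ) : ℤ) := by rw [natCast_mul_period]; exact hψP
  have hker : (Q'.comp (fderiv ℝ (coord skewP L M V) 0)) (resDir (L * M) ψ) = 0 := by
    rw [ContinuousLinearMap.comp_apply]
    have e : (fderiv ℝ (coord skewP L M V) 0) (resDir (L * M) ψ)
        = resDir M (fun y κ => pushDir L V ψ ((L : ℤ) • y) κ) := by
      funext r κ
      rw [fderiv_coord_apply skewP L M V hW, chartDir_skewP_resDir (L * M) hψP' hψs]
      rfl
    rw [e]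
    exact hTc
  have hzero := fermat_of_submersion hloc hFd hAd hsurj hker
  have hder := hasDerivAt_fineAction_chartDir skewP (L * M) V Wf (resDir (L * M) ψ)
  rw [chartDir_skewP_resDir (L * M) hψP' hψs] at hder
  rw [show fderiv ℝ (fun ψ' : TDir d n (L * M) => fineAction (chart skewP (L * M) V ψ') Wf) 0 = fderiv ℝ A 0 from rfl,
    hzero] at hder
  exact hder

/-! ## §3 Bałaban's multi-level constrained minimisers -/

/-- **R0 FOR THE `(j+2)`-LEVEL CONSTRAINED MINIMISERS, GENERAL SUPPORT** — gen 3's `fineCritical_multiLevel` with the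
face-support binder dropped (same proof). [cite: Balaban1985Variational, (115)–(121) p.295] -/
theorem fineCriticalAll_multiLevel [Nonempty n] {L M' : ℕ} [NeZero L] [NeZero M'] (j : ℕ) {V : Site d → Fin d → (Matrix n n ℂ)ˣ}
    (hV : IsUnitaryCfg V) (hVP : IsPeriodicCfg V ((L : ℤ) * (L * tower L M' j : ℕ))) {a b : ℝ} (ha : 0 ≤ a)
    (hab : a < b) (hb : LevelSmall d L (j + 1) b) (hVa : SmallField V a)
    (hmin : ∀ U : Site d → Fin d → (Matrix n n ℂ)ˣ, IsUnitaryCfg U → IsPeriodicCfg U ((L : ℤ) * (L * tower L M' j : ℕ)) →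
      SmallField U b → cavgIter L (j + 2) U = cavgIter L (j + 2) V →
        fineAction V (blockWindow L (periodBox (L * tower L M' j))).2
          ≤ fineAction U (blockWindow L (periodBox (L * tower L M' j))).2) :
    FineCriticalAll L (L * tower L M' j) V (fun φ => levelQ' L M' j (cavg L V) (resDir (L * tower L M' j) φ) = 0) := by
  have hL : 1 ≤ L := Nat.one_le_iff_ne_zero.mpr (NeZero.ne L)
  have hb0 : 0 ≤ b := ha.trans hab.le
  have haS : LevelSmall d L (j + 1) a := LevelSmall.mono ha hab.le hb
  set N : ℕ := L * tower L M' j with hN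
  obtain ⟨hliftA, ha1, -, -⟩ := smallness_of_twoLevelSmall (d := d) hL ha haS.1
  have h512a := small512_of_liftSmall hL ha hliftA
  -- the base `cavg L V` one level up
  have hV₁u : IsUnitaryCfg (cavg L V) := cavg_isUnitaryCfg hL hV ha h512a hVa
  have hV₁P : IsPeriodicCfg (cavg L V) ((L : ℤ) * (tower L M' j : ℕ)) := by
    have h := isPeriodicCfg_cavg L N hVP
    have e : ((N : ℕ) : ℤ) = (L : ℤ) * (tower L M' j : ℕ) := by rw [hN]; push_cast; ring
    rw [e] at h
    exact h
  have hV₁a : SmallField (cavg L V) (prop1Radius d L a) := smallField_cavg hL hV ha h512a hVa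
  haveI : CompleteSpace ↥(skewSub d n M') := FiniteDimensional.complete ℝ _
  have hQ := hasStrictFDerivAt_levelQ (M' := M') hL j hV₁u hV₁P ha1 haS.2 hV₁a
  have hQ' := levelQ'_onto (M' := M') hL j hV₁u hV₁P ha1 haS.2 hV₁a
  -- the top average of `V`
  have hVPt : IsPeriodicCfg V ((tower L M' (j + 2) : ℕ) : ℤ) := by rw [natCast_tower_succ]; exact hVP
  obtain ⟨hXVu, -, -⟩ := cavgIter_unitary_small hL (j + 1) hV ha haS hVa
  have hXVP : IsPeriodicCfg (cavgIter L (j + 2) V) (M' : ℤ) := isPeriodicCfg_cavgIter L M' (j + 2) hVPt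
  -- the side condition: small-field `b` and top averages relatively within `1/4`
  set Near : (Site d → Fin d → (Matrix n n ℂ)ˣ) → Prop := fun U => SmallField U b ∧ ∀ (r : Fin d → Fin M') (κ : Fin d),
    ‖(((cavgIter L (j + 2) V (boxVec M' r) κ)⁻¹ : (Matrix n n ℂ)ˣ) : Matrix n n ℂ) * (cavgIter L (j + 2) U (boxVec M' r) κ : Matrix n n ℂ) - 1‖ ≤ 1 / 4
    with hNear
  have hVP' : IsPeriodicCfg V ((L * N : ℕ) : ℤ) := by rw [natCast_mul_period]; exact hVP
  have hNearE : ∀ᶠ θ in 𝓝 (0 : TDir d n (L * N)), Near (chart skewP (L * N) V θ) := by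
    refine (eventually_smallField_chart skewP (L * N) hVP' hab hVa).and ?_
    refine Filter.eventually_all.mpr fun r => Filter.eventually_all.mpr fun κ => ?_
    have hc0 := continuousAt_cavgIter_chart (d := d) (n := n) hL M' (j + 1) skewP hV hVP ha haS hVa (boxVec M' r) κ
    have hc : ContinuousAt (fun θ : TDir d n (L * N) =>
        ‖(((cavgIter L (j + 2) V (boxVec M' r) κ)⁻¹ : (Matrix n n ℂ)ˣ) : Matrix n n ℂ)
          * ((cavgIter L (j + 2) (chart skewP (L * N) V θ) (boxVec M' r) κ : (Matrix n n ℂ)ˣ) : Matrix n n ℂ) - 1‖) 0 :=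
      ((continuousAt_const.mul hc0).sub continuousAt_const).norm
    have h0 : ‖(((cavgIter L (j + 2) V (boxVec M' r) κ)⁻¹ : (Matrix n n ℂ)ˣ) : Matrix n n ℂ)
        * ((cavgIter L (j + 2) (chart skewP (L * N) V 0) (boxVec M' r) κ : (Matrix n n ℂ)ˣ) : Matrix n n ℂ) - 1‖ < 1 / 4 := by
      rw [chart_zero, Units.inv_mul, sub_self, norm_zero]
      norm_num
    exact (hc.eventually (gt_mem_nhds h0)).mono fun θ hθ => hθ.le
  -- the honest minimality gives the chart-constrained minimality under `Near`
  have hmin' : ∀ U : Site d → Fin d → (Matrix n n ℂ)ˣ, IsUnitaryCfg U → IsPeriodicCfg U ((L : ℤ) * N) → Near U →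
      levelQ L M' j (cavg L V) (cavg L U) = levelQ L M' j (cavg L V) (cavg L V) →
        fineAction V (blockWindow L (periodBox N)).2 ≤ fineAction U (blockWindow L (periodBox N)).2 := by
    intro U hU hUP hUN hUQ
    obtain ⟨hUb, hUnear⟩ := hUN
    rw [levelQ_self] at hUQ
    have hUPt : IsPeriodicCfg U ((tower L M' (j + 2) : ℕ) : ℤ) := by rw [natCast_tower_succ]; exact hUP
    obtain ⟨hXUu, -, -⟩ := cavgIter_unitary_small hL (j + 1) hU hb0 hb hUb
    have hXUP : IsPeriodicCfg (cavgIter L (j + 2) U) (M' : ℤ) := isPeriodicCfg_cavgIter L M' (j + 2) hUPt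
    have heq : cavgIter L (j + 2) U = cavgIter L (j + 2) V :=
      eq_of_skewPR_relLog_eq_zero hXVP hXUP hXVu hXUu hUnear hUQ
    exact hmin U hU hUP hUb heq
  exact fineCriticalAll_of_isLocalMin (M := N) hV hVP ha hliftA hVa (levelQ L M' j (cavg L V))
    (levelQ' L M' j (cavg L V)) hQ hQ' Near hNearE hmin'

/-- **R0 with the tree's `k`-fold average, general support**: the composite constraint written as
`avgIter L U (j+2) = avgIter L V (j+2)`. [cite: Balaban1985Variational, (115)–(121) p.295] -/
theorem fineCriticalAll_avgIter [Nonempty n] {L M' : ℕ} [NeZero L] [NeZero M'] (j : ℕ) {V : Site d → Fin d → (Matrix n n ℂ)ˣ}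
    (hV : IsUnitaryCfg V) (hVP : IsPeriodicCfg V ((L : ℤ) * (L * tower L M' j : ℕ))) {a b : ℝ} (ha : 0 ≤ a)
    (hab : a < b) (hb : LevelSmall d L (j + 1) b) (hVa : SmallField V a)
    (hmin : ∀ U : Site d → Fin d → (Matrix n n ℂ)ˣ, IsUnitaryCfg U → IsPeriodicCfg U ((L : ℤ) * (L * tower L M' j : ℕ)) →
      SmallField U b → avgIter L U (j + 2) = avgIter L V (j + 2) →
        fineAction V (blockWindow L (periodBox (L * tower L M' j))).2
          ≤ fineAction U (blockWindow L (periodBox (L * tower L M' j))).2) :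
    FineCriticalAll L (L * tower L M' j) V (fun φ => levelQ' L M' j (cavg L V) (resDir (L * tower L M' j) φ) = 0) :=
  fineCriticalAll_multiLevel j hV hVP ha hab hb hVa fun U hU hUP hUb hUeq =>
    hmin U hU hUP hUb (by rw [← cavgIter_eq_avgIter, ← cavgIter_eq_avgIter]; exact hUeq)

end

end Summit.QuantumFields.BalabanUV.T4Continuum.AveragingDeficitFermatAll
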